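import Summits.ABC.IUTFork.Conditional.WRowFrey283Packages
import HarnessLib

/-!
# R-W WINDOW-TABLE, W1 ROW DECISION (inhabited side): the known abc triple `283 + 5¹¹·13² = 2⁸·3⁸·17³` at `l = 17`
# — the hull licence S_H HOLDS at every genuine Θ-volume datum over `(ratPoint (283/2⁸3⁸17³), 17)` of the TABULATED LOCAL TYPE

PROOF-ONLY file (D-0012; 0 definitions, 0 `Prop` facts) of the abc-iut cell — D-0079 RESCUE sub-cell R-W «WINDOW Θ-SIDE INEQUALITY», W1 ROW
DECISIONS composer seat abc-iut-W-row-1 (gen 0); row 2 of HOME/plan/rescue/R-W/OPEN-10.md (sha16 1b0025ee7a8ba6d7, abc-iut-rw-num-lead):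
`pilotDataOfK:frey-283-8251953125-8251953408:17`. Over `WRowFrey283Packages` (local packages, pole orders, bad primes) and the sockets
`Cor312LicenceWildInhabitedRealising` / `…GenuineK` (abc-iut-w4-d036's U2-LICENCE-WRAPPER p460046/p460573 composed over all tuples).
TAKES NO SIDE on [IUTchIII] Cor. 3.12 (S. Mochizuki, *Inter-universal Teichmüller theory III*, Cor. 3.12 p. 173–174; Step (xi-f) p. 184) or on
any author; «inhabited as typed» ≠ «asserted in print».

WHAT IS PROVED (namespace `Summit.ABC.IUTFork.Conditional`): **`WRow.licence_frey283_seventeen`** — for EVERY genuine Θ-volume datum `T` at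
`(ratPoint (283/8251953408), 17)` and EVERY pair of realising Θ- and q-ideles: IF the bad completions have the LOCAL TYPE of the table (wild at
`3, 5`: ramification index and a lower bound on the different; tame poles: ramification index; a common candidate at `283`) and are pairwise
`ℚ_p`-isomorphic over each bad prime, THEN abc-iut-c312-1's `Thm311ToCor312.Licence` HOLDS at `settingPrVolSharp (pilotDataOfK T.D T.K) …`
(branch C's «∃ ρ qK, QPinned ∧ PilotKummerCompatHull» follows by abc-iut-w5-d009's `exists_qPinned_and_hull_settingPrVolSharp_iff_licence`).
READING (neutral; numbers, not adjectives): the per-datum S_H clause of the window certificates' binder `hSHwBad` (p453137 / p450130) is INHABITED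
at this Szpiro-BAD admissible-candidate row CONDITIONALLY on the local type at the bad primes (GAP-LEDGER G-Wnum2-1 at `3, 5`; the pinned tame
types of abc-iut-W-num-3) and the conjugacy of the bad fibre — no number-level hypothesis is consumed. Admissibility / (P6) of `(ratPoint λ, 17)`
and NON-EMPTINESS of the datum type are NOT claimed. HONEST SCOPE: OUR sharp containers; STRONGER-THAN-PRINT hull reading; nothing about the
printed inequality or any author's intended hull; typed ≠ proved; instantiated ≠ endorsed; no abc claim.
[cite: Mochizuki2012, IUTchI Def. 3.1 (b),(c) pp. 61–62, Ex. 3.2 (iv) p. 71; IUTchIII Cor. 3.12 Step (xi-f) p. 184; IUTchIV Prop. 1.1 p. 9,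
Prop. 1.2 (i)(ii) p. 10, Prop. 1.4 (ii) p. 13, Cor. 2.2 (ii) proof (P5) p. 46] [cite: DupuyHilado2025, §3.3, §3.4, §4.9, §4.12]
[cite: NeukirchANT1999, Ch. II (5.5)] [claim: Mochizuki2012, status: disputed] for every IUT sentence.
-/

noncomputable section

open Set Function Metric NumberField IsDedekindDomain

namespace Summit.ABC.IUTFork.Conditional

open Thm311 Thm311.Real Cor312 Cor312Vol Cor312Prov Literature.IUT.LogThetaLattice Literature.IUT.LogVolume
  Literature.IUT.HodgeTheaters Literature.IUT.LogVolume.Cor22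
open Literature.NumberTheory.NumberFields Literature.NumberTheory.GaloisRepresentations.Ultrametric
open Literature.NumberTheory.DiophantineGeometry Literature.NumberTheory.DiophantineGeometry.GenEll

/-! ## The row `pilotDataOfK:frey-283-8251953125-8251953408:17`: S_H INHABITED at the tabulated local type -/

/-- **W1 ROW DECISION, INHABITED SIDE — `283 + 5¹¹·13² = 2⁸·3⁸·17³` at `l = 17`.** For EVERY genuine Θ-volume datum `T` at
`(ratPoint (283/8251953408), 17)` ([IUTchIV] Cor. 2.2 (ii) proof (P7)) and EVERY pair of Θ- and q-ideles realising the pilot divisors of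
`X := pilotDataOfK T.D T.K`: IF the completions at the bad places have the TABULATED LOCAL TYPE — over `3`: `e = 510` and different exponent `≥ 1019`; over `5`: `e = 1020` and different exponent `≥ 2039` (GAP-LEDGER G-Wnum2-1, wild);
over `13`: `e = 255`; over `283`: a common `e ∈ {255, 510}` — and are pairwise `ℚ_p`-isomorphic over each bad prime (conjugate fibre), THEN
abc-iut-c312-1's `Thm311ToCor312.Licence` HOLDS at abc-iut-c312-7's `settingPrVolSharp X …` (the per-datum S_H of the window certificates,
INHABITED). Shell radii DERIVED (inner read trivially `ρin = 1` by volume at `3, 5`, abc-iut-c312-3's closed form elsewhere; outer = envelope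
`p^{a₀} − e·a₀`); integer cells at every label `j ≤ 8` by `decide` (margins ≥ 5922 (p=3), 6255 (5), 1222 (13), 268/994 (283)). [cite: Mochizuki2012, IUTchIII Cor. 3.12 Step (xi-f) p. 184;
IUTchIV Prop. 1.1 p. 9, Prop. 1.2 (i)(ii) p. 10, Cor. 2.2 (ii) p. 46] [cite: DupuyHilado2025, §3.3, §3.4, §4.9, §4.12] [claim: Mochizuki2012, status: disputed] -/
theorem WRow.licence_frey283_seventeen (T : Cor22.ThetaVolumeDatumAt (ratPoint ((283 : ℚ) / 8251953408)) 17) (e283 : ℕ)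
    (he283 : e283 = 255 ∨ e283 = 510) :
    letI := T.instFieldF; letI := T.instNumberFieldF; letI := T.instAlgebraF; letI := T.instFieldK
    letI := T.instNumberFieldK; letI := T.instAlgebraK; letI := T.instFieldFbar; letI := T.instAlgebraFbar
    letI := T.instAlgebraKFbar; letI := T.instIsElliptic
    -- LOCAL TYPE at the bad primes (hypotheses) and conjugacy of the bad fibre
    (∀ (pp : Nat.Primes), (pp : ℕ) = 3 → ∀ x : (thetaIndex (pilotDataOfK T.D T.K)).Fibre (.inr pp),
        haveI : Fact (pp : ℕ).Prime := ⟨pp.2⟩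
        placeOf (pilotDataOfK T.D T.K) pp.1 x ∈ (pilotDataOfK T.D T.K).S →
          absRamificationIdx (pp : ℕ) (kOf (pilotDataOfK T.D T.K) pp.1 x) = 510 ∧
            ((1019 : ℕ) : ℝ) / ((510 : ℕ) : ℝ) ≤ differentOrd (pp : ℕ) (kOf (pilotDataOfK T.D T.K) pp.1 x)) →
    (∀ (pp : Nat.Primes), (pp : ℕ) = 5 → ∀ x : (thetaIndex (pilotDataOfK T.D T.K)).Fibre (.inr pp),
        haveI : Fact (pp : ℕ).Prime := ⟨pp.2⟩
        placeOf (pilotDataOfK T.D T.K) pp.1 x ∈ (pilotDataOfK T.D T.K).S →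
          absRamificationIdx (pp : ℕ) (kOf (pilotDataOfK T.D T.K) pp.1 x) = 1020 ∧
            ((2039 : ℕ) : ℝ) / ((1020 : ℕ) : ℝ) ≤ differentOrd (pp : ℕ) (kOf (pilotDataOfK T.D T.K) pp.1 x)) →
    (∀ (pp : Nat.Primes), (pp : ℕ) = 13 → ∀ x : (thetaIndex (pilotDataOfK T.D T.K)).Fibre (.inr pp),
        haveI : Fact (pp : ℕ).Prime := ⟨pp.2⟩
        placeOf (pilotDataOfK T.D T.K) pp.1 x ∈ (pilotDataOfK T.D T.K).S →
          absRamificationIdx (pp : ℕ) (kOf (pilotDataOfK T.D T.K) pp.1 x) = 255) →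
    (∀ (pp : Nat.Primes), (pp : ℕ) = 283 → ∀ x : (thetaIndex (pilotDataOfK T.D T.K)).Fibre (.inr pp),
        haveI : Fact (pp : ℕ).Prime := ⟨pp.2⟩
        placeOf (pilotDataOfK T.D T.K) pp.1 x ∈ (pilotDataOfK T.D T.K).S →
          absRamificationIdx (pp : ℕ) (kOf (pilotDataOfK T.D T.K) pp.1 x) = e283) →
    (∀ (pp : Nat.Primes) (x y : (thetaIndex (pilotDataOfK T.D T.K)).Fibre (.inr pp)),
      haveI : Fact (pp : ℕ).Prime := ⟨pp.2⟩
      placeOf (pilotDataOfK T.D T.K) pp.1 x ∈ (pilotDataOfK T.D T.K).S → placeOf (pilotDataOfK T.D T.K) pp.1 y ∈ (pilotDataOfK T.D T.K).S →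
        Nonempty (kOf (pilotDataOfK T.D T.K) pp.1 x ≃ₐ[ℚ_[pp]] kOf (pilotDataOfK T.D T.K) pp.1 y)) →
    ∀ {logv : PadicLogs T.K} (hlog : LogvAnalytic logv) (M : Type) [Field M] [NumberField M]
      (archPk : ∀ (j : (thetaIndex (pilotDataOfK T.D T.K)).Label) (vQ : (thetaIndex (pilotDataOfK T.D T.K)).VQ),
        Set ((logShellsDH (pilotDataOfK T.D T.K) logv).Packet j vQ))
      (archSub : ∀ (j : (thetaIndex (pilotDataOfK T.D T.K)).Label) (v : (thetaIndex (pilotDataOfK T.D T.K)).V),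
        Set ((logShellsDH (pilotDataOfK T.D T.K) logv).Packet j ((thetaIndex (pilotDataOfK T.D T.K)).over v)))
      (Ψ : ℤ → ∀ v : (thetaIndex (pilotDataOfK T.D T.K)).V, v ∈ (thetaIndex (pilotDataOfK T.D T.K)).Vbad →
        Set ((logShellsDH (pilotDataOfK T.D T.K) logv).StarPacket v))
      (act : ℤ → ∀ v : (thetaIndex (pilotDataOfK T.D T.K)).V, v ∈ (thetaIndex (pilotDataOfK T.D T.K)).Vbad →
        (logShellsDH (pilotDataOfK T.D T.K) logv).StarPacket v → Module.End ℚ ((logShellsDH (pilotDataOfK T.D T.K) logv).StarPacket v))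
      (Mmod : ℤ → ∀ j : (thetaIndex (pilotDataOfK T.D T.K)).LabelStar, Set ((logShellsDH (pilotDataOfK T.D T.K) logv).GlobalPacket j.1))
      (region : ℤ → ∀ j : (thetaIndex (pilotDataOfK T.D T.K)).LabelStar, FinDivisor M → ∀ vQ : (thetaIndex (pilotDataOfK T.D T.K)).VQ,
        Set ((logShellsDH (pilotDataOfK T.D T.K) logv).Packet j.1 vQ))
      (n : ℤ) {HT : Type} {LogLink : HT → HT → Type} {IsFull : ∀ {s t : HT}, LogLink s t → Prop}
      (lat : LGPGaussianLogThetaLattice LogLink IsFull)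
      {Frd : Type} {IsoF : Frd → Frd → Type} {Ob : Frd → Type} {realify : Frd → Frd} {Strip : Type}
      {IsoS : Strip → Strip → Type} {Mv : ∀ v : (thetaIndex (pilotDataOfK T.D T.K)).V, v ∈ (thetaIndex (pilotDataOfK T.D T.K)).Vbad → Type}
      [∀ v h, Monoid (Mv v h)]
      (sig : GlobalLGPFrobenioidSignature (thetaIndex (pilotDataOfK T.D T.K)).lstar (thetaIndex (pilotDataOfK T.D T.K)).V
        (· ∈ (thetaIndex (pilotDataOfK T.D T.K)).Vbad) Frd IsoF Ob realify Strip IsoS Mv)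
      (split : SplittingMonoids Mv) {ObΔ : Type} {N : ∀ v : (thetaIndex (pilotDataOfK T.D T.K)).V, v ∈ (thetaIndex (pilotDataOfK T.D T.K)).Vbad → Type}
      [∀ v h, Monoid (N v h)] (qData : QPilotData ObΔ N)
      (tq : ∀ (pp : Nat.Primes) (x : (thetaIndex (pilotDataOfK T.D T.K)).Fibre (.inr pp)),
        haveI : Fact (pp : ℕ).Prime := ⟨pp.2⟩; kOf (pilotDataOfK T.D T.K) pp.1 x)
      (t : ∀ (pp : Nat.Primes) (_ : Fin (pilotDataOfK T.D T.K).lstar) (x : (thetaIndex (pilotDataOfK T.D T.K)).Fibre (.inr pp)),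
        haveI : Fact (pp : ℕ).Prime := ⟨pp.2⟩; kOf (pilotDataOfK T.D T.K) pp.1 x)
      (htq0 : ∀ pp x, tq pp x ≠ 0)
      (htq1 : ∀ (pp : Nat.Primes) (x : (thetaIndex (pilotDataOfK T.D T.K)).Fibre (.inr pp)),
        haveI : Fact (pp : ℕ).Prime := ⟨pp.2⟩; placeOf (pilotDataOfK T.D T.K) pp.1 x ∉ (pilotDataOfK T.D T.K).S → ‖tq pp x‖ = 1)
      (_ht0 : ∀ pp i x, t pp i x ≠ 0)
      (_ht : ∀ (pp : Nat.Primes) (i : Fin (pilotDataOfK T.D T.K).lstar) (x : (thetaIndex (pilotDataOfK T.D T.K)).Fibre (.inr pp)),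
        haveI : Fact (pp : ℕ).Prime := ⟨pp.2⟩
        Real.log ‖t pp i x‖ = -((pilotDataOfK T.D T.K).thetaPilot i (placeOf (pilotDataOfK T.D T.K) pp.1 x)) *
          logNorm T.K (placeOf (pilotDataOfK T.D T.K) pp.1 x) / localDegree T.K (placeOf (pilotDataOfK T.D T.K) pp.1 x))
      (_htq : ∀ (pp : Nat.Primes) (x : (thetaIndex (pilotDataOfK T.D T.K)).Fibre (.inr pp)),
        haveI : Fact (pp : ℕ).Prime := ⟨pp.2⟩
        Real.log ‖tq pp x‖ = -((pilotDataOfK T.D T.K).qPilot (placeOf (pilotDataOfK T.D T.K) pp.1 x)) *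
          logNorm T.K (placeOf (pilotDataOfK T.D T.K) pp.1 x) / localDegree T.K (placeOf (pilotDataOfK T.D T.K) pp.1 x)),
      Thm311ToCor312.Licence
        (settingPrVolSharp (pilotDataOfK T.D T.K) hlog M archPk archSub Ψ act Mmod region n lat sig split qData tq t htq0 htq1) := by
  letI := T.instFieldF; letI := T.instNumberFieldF; letI := T.instAlgebraF; letI := T.instFieldK
  letI := T.instNumberFieldK; letI := T.instAlgebraK; letI := T.instFieldFbar; letI := T.instAlgebraFbar
  letI := T.instAlgebraKFbar; letI := T.instIsElliptic
  intro hloc3 hloc5 hloc13 hloc283 hiso logv hlog M _ _ archPk archSub Ψ act Mmod region n HT LogLink IsFull lat Frd IsoF Ob realify Strip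
    IsoS Mv _ sig split ObΔ N _ qData tq t htq0 htq1 ht0 ht htq
  have hjF : T.E.j = ((jInv ((283 : ℚ) / 8251953408) : ℚ) : T.F) := by rw [T.j_eq]; exact eq_ratCast _ _
  have hlstar : (pilotDataOfK T.D T.K).lstar = 8 := by
    show ((pilotDataOfK T.D T.K).l - 1) / 2 = 8
    rw [pilotDataOfK_l]
  -- the per-prime data (e, D, h, ρin, ρout)
  set eF : Nat.Primes → ℕ := fun pp => if (pp : ℕ) = 3 then 510 else if (pp : ℕ) = 5 then 1020 else if (pp : ℕ) = 13 then 255 else e283 with heF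
  set DF : Nat.Primes → ℕ := fun pp => if (pp : ℕ) = 3 then 1019 else if (pp : ℕ) = 5 then 2039 else if (pp : ℕ) = 13 then 254 else e283 - 1 with hDF
  set hF : Nat.Primes → ℕ := fun pp => if (pp : ℕ) = 2 then 16 else if (pp : ℕ) = 3 then 16 else if (pp : ℕ) = 5 then 22 else if (pp : ℕ) = 13 then 4 else if (pp : ℕ) = 17 then 6 else 2 with hhF
  set rinF : Nat.Primes → ℤ := fun pp => if (pp : ℕ) = 3 then 1 else if (pp : ℕ) = 5 then 1 else if (pp : ℕ) = 13 then 22 else if e283 = 255 then 1 else 2 with hrinF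
  set routF : Nat.Primes → ℤ := fun pp => if (pp : ℕ) = 3 then (-2331) else if (pp : ℕ) = 5 then (-3455) else if (pp : ℕ) = 13 then (-341) else if e283 = 255 then (1) else (-227) with hroutF
  refine Cor312Prov.licence_settingPrVolSharp_pilotDataOfK_of_orders_rat T.D hlog M archPk archSub Ψ act Mmod region n lat sig split qData
    tq t htq0 htq1 ht0 ht htq (jInv ((283 : ℚ) / 8251953408)) hjF eF DF hF rinF routF (fun pp x hx => ?_) hiso (fun pp hpp i => ?_)
  · -- the local packages at a bad place `x | p`
    haveI : Fact (pp : ℕ).Prime := ⟨pp.2⟩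
    rcases (WRow.bad_prime_frey283 T pp x hx).2 with ⟨hp, hord⟩ | ⟨hp, hord⟩ | ⟨hp, hord⟩ | ⟨hp, -⟩ | ⟨hp, hord⟩
    · have h1 : eF pp = 510 := by simp [heF, hp]
      have h2 : DF pp = 1019 := by simp [hDF, hp]
      have h3 : hF pp = 16 := by simp [hhF, hp]
      have h4 : rinF pp = 1 := by simp [hrinF, hp]
      have h5 : routF pp = (-2331) := by simp [hroutF, hp]
      rw [h1, h2, h3, h4, h5]
      obtain ⟨he, hD⟩ := hloc3 pp hp x hx
      exact ⟨he, hD, WRow.inner_witness_trivial (pp : ℕ) _ 510,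
        WRow.outer_witness_envelope (pp : ℕ) _ he 6 (by rw [hp]; decide) (by rw [hp]; decide) (-2331) (by rw [hp]; norm_num),
        by simpa using hord, by decide⟩
    · have h1 : eF pp = 1020 := by simp [heF, hp]
      have h2 : DF pp = 2039 := by simp [hDF, hp]
      have h3 : hF pp = 22 := by simp [hhF, hp]
      have h4 : rinF pp = 1 := by simp [hrinF, hp]
      have h5 : routF pp = (-3455) := by simp [hroutF, hp]
      rw [h1, h2, h3, h4, h5]
      obtain ⟨he, hD⟩ := hloc5 pp hp x hx
      exact ⟨he, hD, WRow.inner_witness_trivial (pp : ℕ) _ 1020,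
        WRow.outer_witness_envelope (pp : ℕ) _ he 4 (by rw [hp]; decide) (by rw [hp]; decide) (-3455) (by rw [hp]; norm_num),
        by simpa using hord, by decide⟩
    · have h1 : eF pp = 255 := by simp [heF, hp]
      have h2 : DF pp = 254 := by simp [hDF, hp]
      have h3 : hF pp = 4 := by simp [hhF, hp]
      have h4 : rinF pp = 22 := by simp [hrinF, hp]
      have h5 : routF pp = (-341) := by simp [hroutF, hp]
      rw [h1, h2, h3, h4, h5]
      have he := hloc13 pp hp x hx
      exact ⟨he, WRow.different_lower_of_not_dvd (pp : ℕ) _ he (by rw [hp]; norm_num) 254 (by norm_num),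
        WRow.inner_witness_of_not_dvd (pp : ℕ) _ he (by rw [hp]; norm_num) 22 (by rw [hp]; norm_num),
        WRow.outer_witness_envelope (pp : ℕ) _ he 2 (by rw [hp]; decide) (by rw [hp]; decide) (-341) (by rw [hp]; norm_num),
        by simpa using hord, by decide⟩
    · exact absurd hp (WRow.bad_prime_frey283 T pp x hx).1
    · have he := hloc283 pp hp x hx
      rcases he283 with rfl | rfl
      · have h1 : eF pp = 255 := by simp [heF, hp]
        have h2 : DF pp = 254 := by simp [hDF, hp]
        have h3 : hF pp = 2 := by simp [hhF, hp]
        have h4 : rinF pp = 1 := by simp [hrinF, hp]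
        have h5 : routF pp = 1 := by simp [hroutF, hp]
        rw [h1, h2, h3, h4, h5]
        exact ⟨he, WRow.different_lower_of_not_dvd (pp : ℕ) _ he (by rw [hp]; norm_num) 254 (by norm_num),
          WRow.inner_witness_of_not_dvd (pp : ℕ) _ he (by rw [hp]; norm_num) 1 (by rw [hp]; norm_num),
          WRow.outer_witness_envelope (pp : ℕ) _ he 0 (by rw [hp]; decide) (by rw [hp]; decide) 1 (by rw [hp]; norm_num),
          by simpa using hord, by decide⟩
      · have h1 : eF pp = 510 := by simp [heF, hp]
        have h2 : DF pp = 509 := by simp [hDF, hp]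
        have h3 : hF pp = 2 := by simp [hhF, hp]
        have h4 : rinF pp = 2 := by simp [hrinF, hp]
        have h5 : routF pp = (-227) := by simp [hroutF, hp]
        rw [h1, h2, h3, h4, h5]
        exact ⟨he, WRow.different_lower_of_not_dvd (pp : ℕ) _ he (by rw [hp]; norm_num) 509 (by norm_num),
          WRow.inner_witness_of_not_dvd (pp : ℕ) _ he (by rw [hp]; norm_num) 2 (by rw [hp]; norm_num),
          WRow.outer_witness_envelope (pp : ℕ) _ he 1 (by rw [hp]; decide) (by rw [hp]; decide) (-227) (by rw [hp]; norm_num),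
          by simpa using hord, by decide⟩
  · -- the integer cells at every label `j = i + 1 ≤ 8`
    haveI : Fact (pp : ℕ).Prime := ⟨pp.2⟩
    obtain ⟨x, hx⟩ := hpp
    have hi : (i : ℕ) < 8 := hlstar ▸ i.isLt
    generalize hk : (i : ℕ) = k at hi ⊢
    rcases (WRow.bad_prime_frey283 T pp x hx).2 with ⟨hp, -⟩ | ⟨hp, -⟩ | ⟨hp, -⟩ | ⟨hp, -⟩ | ⟨hp, -⟩
    · have h1 : eF pp = 510 := by simp [heF, hp]
      have h2 : DF pp = 1019 := by simp [hDF, hp]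
      have h3 : hF pp = 16 := by simp [hhF, hp]
      have h4 : rinF pp = 1 := by simp [hrinF, hp]
      have h5 : routF pp = (-2331) := by simp [hroutF, hp]
      rw [h1, h2, h3, h4, h5]
      interval_cases k <;> decide
    · have h1 : eF pp = 1020 := by simp [heF, hp]
      have h2 : DF pp = 2039 := by simp [hDF, hp]
      have h3 : hF pp = 22 := by simp [hhF, hp]
      have h4 : rinF pp = 1 := by simp [hrinF, hp]
      have h5 : routF pp = (-3455) := by simp [hroutF, hp]
      rw [h1, h2, h3, h4, h5]
      interval_cases k <;> decide
    · have h1 : eF pp = 255 := by simp [heF, hp]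
      have h2 : DF pp = 254 := by simp [hDF, hp]
      have h3 : hF pp = 4 := by simp [hhF, hp]
      have h4 : rinF pp = 22 := by simp [hrinF, hp]
      have h5 : routF pp = (-341) := by simp [hroutF, hp]
      rw [h1, h2, h3, h4, h5]
      interval_cases k <;> decide
    · exact absurd hp (WRow.bad_prime_frey283 T pp x hx).1
    · rcases he283 with rfl | rfl
      · have h1 : eF pp = 255 := by simp [heF, hp]
        have h2 : DF pp = 254 := by simp [hDF, hp]
        have h3 : hF pp = 2 := by simp [hhF, hp]
        have h4 : rinF pp = 1 := by simp [hrinF, hp]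
        have h5 : routF pp = 1 := by simp [hroutF, hp]
        rw [h1, h2, h3, h4, h5]
        interval_cases k <;> decide
      · have h1 : eF pp = 510 := by simp [heF, hp]
        have h2 : DF pp = 509 := by simp [hDF, hp]
        have h3 : hF pp = 2 := by simp [hhF, hp]
        have h4 : rinF pp = 2 := by simp [hrinF, hp]
        have h5 : routF pp = (-227) := by simp [hroutF, hp]
        rw [h1, h2, h3, h4, h5]
        interval_cases k <;> decide

end Summit.ABC.IUTFork.Conditional

end
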